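import Mathlib
import Summits.Ventures.HodgeRepro2.BridgeCoprime

/-!
# BridgeSeparation — the Weil projector with rational coefficients from eigenvalue separation alone
(Tier 4, T4-A; TIER4.md Lemmas A2.1–A2.2, Prop. A2.3)

Seat p4 of the blind cell pub-hodge-repro2 (README §6, T4-A). route/TIER4.md proves that the
projector `p_W` onto the split Weil line is `P([x]^*)` with `P ∈ ℚ[T]` through Lagrange interpolation
over `ℂ` followed by a Galois-invariance argument (Lemma A2.2 (ii)). This file shows that the Galois
argument can be dispensed with: with `W` defined intrinsically (`W = ⋀⁴_𝐅 H¹(B,ℚ)`, a ℚ-subspace on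
which `T = [x]^*` acts as the scalar `α = x⁴ ∈ 𝐅`) one may take

* `p := minpoly ℚ α` — it kills `W` (`aeval_minpoly_apply_eq_zero`), and
* `q :=` the characteristic polynomial of `T` on `V ⧸ W` — Cayley–Hamilton sends `V` into `W`,

both in `ℚ[X]` by construction, and `IsCoprime p q` follows from EIGENVALUE SEPARATION alone
(`isCoprime_of_no_common_root`: no complex root of `p` is a root of `q` — Lemma A2.1). Then
`BridgeCoprime.exists_aeval_proj` produces `r ∈ ℚ[X]` with `r(T)` the projector onto `W` preserving
every `T`-stable subspace (`exists_aeval_proj_of_separation`). Summary for the prose: A2.2 (ii) is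
not needed; A2.1 (separation) + Cayley–Hamilton + Bézout give `P ∈ ℚ[T]` directly.
-/

namespace Summit.Ventures.HodgeRepro2.BridgeSeparation

open Polynomial Summit.Ventures.HodgeRepro2.BridgeCoprime

section Scalar

variable {F : Type*} [Field F] [Algebra ℚ F] {W : Type*} [AddCommGroup W] [Module ℚ W] [Module F W]
  [IsScalarTower ℚ F W]

/-- If `T` acts on `W` as the `F`-scalar `α`, every ℚ-polynomial `p` in `T` acts as `p(α)`. -/
theorem aeval_apply_eq_aeval_smul (T : Module.End ℚ W) (α : F) (hT : ∀ w, T w = α • w)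
    (p : ℚ[X]) (w : W) : (aeval T p) w = (aeval α p) • w := by
  induction p using Polynomial.induction_on' with
  | add p q hp hq => rw [map_add, LinearMap.add_apply, hp, hq, map_add, add_smul]
  | monomial n a =>
    have hpow : ∀ n : ℕ, (T ^ n) w = α ^ n • w := by
      intro n
      induction n with
      | zero => simp
      | succ n ih => rw [pow_succ', Module.End.mul_apply, ih, hT, smul_smul, ← pow_succ']
    rw [aeval_monomial, aeval_monomial, Module.End.mul_apply, Module.algebraMap_end_apply, hpow,
      ← IsScalarTower.algebraMap_smul F a, smul_smul]

/-- The minimal polynomial of `α` over `ℚ`, evaluated at `T`, kills `W` when `T = α •` on `W`. -/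
theorem aeval_minpoly_apply_eq_zero (T : Module.End ℚ W) (α : F) (hT : ∀ w, T w = α • w) (w : W) :
    (aeval T (minpoly ℚ α)) w = 0 := by
  rw [aeval_apply_eq_aeval_smul T α hT, minpoly.aeval, zero_smul]

end Scalar

section Coprime

/-- **Eigenvalue separation gives coprimality**: two rational polynomials with no common complex root
are coprime in `ℚ[X]` (so Bézout coefficients exist in `ℚ[X]`, no Galois argument needed). -/
theorem isCoprime_of_no_common_root (p q : ℚ[X])
    (h : ∀ a : ℂ, aeval a p = 0 → aeval a q ≠ 0) : IsCoprime p q := by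
  refine (Polynomial.isCoprime_iff_aeval_ne_zero_of_isAlgClosed ℚ ℂ p q).2 fun a => ?_
  by_cases hp : aeval a p = 0
  · exact Or.inr (h a hp)
  · exact Or.inl hp

end Coprime

section Projector

variable {V : Type*} [AddCommGroup V] [Module ℚ V] [FiniteDimensional ℚ V]
  {F : Type*} [Field F] [Algebra ℚ F]

omit [FiniteDimensional ℚ V] in
/-- If `T` acts on the subspace `W` (with its `F`-structure) as the `F`-scalar `α`, then every
ℚ-polynomial in `T` acts on `W` as `p(α)`. -/
theorem aeval_apply_coe_eq (T : Module.End ℚ V) (W : Submodule ℚ V) [Module F W]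
    [IsScalarTower ℚ F W] (α : F) (hT : ∀ w : W, T (w : V) = ((α • w : W) : V)) (p : ℚ[X])
    (w : W) : (aeval T p) (w : V) = (((aeval α p) • w : W) : V) := by
  induction p using Polynomial.induction_on' with
  | add p q hp hq =>
    rw [map_add, LinearMap.add_apply, hp, hq, map_add, add_smul, Submodule.coe_add]
  | monomial n a =>
    have hpow : ∀ n : ℕ, (T ^ n) (w : V) = (((α ^ n) • w : W) : V) := by
      intro n
      induction n with
      | zero => simp
      | succ n ih => rw [pow_succ', Module.End.mul_apply, ih, hT, smul_smul, ← pow_succ']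
    rw [aeval_monomial, aeval_monomial, Module.End.mul_apply, Module.algebraMap_end_apply, hpow,
      ← Submodule.coe_smul, ← IsScalarTower.algebraMap_smul F a, smul_smul]

/-- **The Weil projector from separation alone** (TIER4.md A2.1–A2.3 without Lemma A2.2 (ii)).
Let `T` be a ℚ-linear operator on `V`, `W ≤ V` `T`-stable, and suppose `W` carries an `F`-vector
space structure (compatible with ℚ) on which `T` is the scalar `α ∈ F`. If no complex root of
`minpoly ℚ α` is a root of the characteristic polynomial of `T` on `V ⧸ W` (eigenvalue separation),
then there is `r ∈ ℚ[X]` with `r(T)` the identity on `W`, mapping `V` into `W`, and mapping every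
`T`-stable subspace `A` into `A ⊓ W`. -/
theorem exists_aeval_proj_of_separation (T : Module.End ℚ V) (W : Submodule ℚ V)
    (hW : W ≤ W.comap T) [Module F W] [IsScalarTower ℚ F W] (α : F)
    (hT : ∀ w : W, T (w : V) = ((α • w : W) : V))
    (hsep : ∀ a : ℂ, aeval a (minpoly ℚ α) = 0 → aeval a (quotMap T W hW).charpoly ≠ 0) :
    ∃ r : ℚ[X], (∀ w ∈ W, (aeval T r) w = w) ∧ (∀ v, (aeval T r) v ∈ W) ∧
      ∀ A : Submodule ℚ V, (∀ v ∈ A, T v ∈ A) → ∀ v ∈ A, (aeval T r) v ∈ A ⊓ W := by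
  have hp : ∀ w ∈ W, (aeval T (minpoly ℚ α)) w = 0 := by
    intro w hw
    have h := aeval_apply_coe_eq T W α hT (minpoly ℚ α) ⟨w, hw⟩
    rw [minpoly.aeval, zero_smul, Submodule.coe_zero] at h
    exact h
  exact exists_aeval_proj T hW hp (isCoprime_of_no_common_root _ _ hsep)

end Projector

end Summit.Ventures.HodgeRepro2.BridgeSeparation
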